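import Summits.BirchSwinnertonDyer.Rank1Residual.Additive.X3BranchCertificateRoad
import Summits.BirchSwinnertonDyer.Rank1Residual.Additive.X3BranchMultEndStateOfFacts
import Summits.BirchSwinnertonDyer.Rank1Residual.Additive.CensusQ6UnitCoeffCertificate
import HarnessLib

/-!
# X3♯(M), rank `0`, every odd `p`: the CERTIFICATE ROAD end state — `ChiBranchLowerLeadingTerm[Odd]At W p`,
# `Typed.MissingLowerBoundAt W p` and `BSD(E,p)` from PUBLISHED records ∧ ONE unit-coefficient
# certificate ∧ the algebraic `λ` (`hLamW`), with NO analytic congruence `hGVM`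
# (cell `bsd-eis`, seat `bsd-eis-x3` gen 2; sequel of `X3BranchCertificateRoad.lean`; route K1
# `AdditiveBranchIMC`, crux `MultLower` — supports only)

HONEST FRAMING (cell `bsd-eis`, `run/shared/lean/pub/bsd-eis/README.md` §4): the programme's target of
record is the full Birch–Swinnerton-Dyer formula for every `E/ℚ` of analytic rank `≤ 1`; this file
concerns X3♯(M) ∩ `r_an = 0` (`E = W` additive potentially multiplicative at the odd `p`, `E[p]`
reducible; every twist model `V` with `C • V^{(p*)} = W` multiplicative at `p`). THEOREMS ONLY (no
`def`, no named fact, no `sorry`); nothing booked. On these rows the analytic congruence `hGVM` of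
bsd-addord's `X3BranchMultEndStateOfFacts.lean` is NOT in print (GV's standing hypothesis excludes a
character ramified at a prime dividing the level); this file replaces it by the TWO per-pair
displayed inputs of `X3BranchCertificateRoad.lean`: `hcert` (for every twist model `V`: the
unit-coefficient certificate `X3BranchUnitCoeffCertAt V p n`, an INSTRUMENT datum) and `hLamW` (the
algebraic `λ` of `X(E/ℚ_∞)` is `n`; §3 derives it from bsd-addord's (M) count + the displayed
EVALUATION `hn`). Every other hypothesis is a PUBLISHED record (`hW16`, `hDel98`, `hDelX`, `hPal`,
`hGZK`, `hmod`, `hmodD`; in §3 `h23`, `h414`, `hT40`, `hT41` and the reading-fact lifting `hlift`) or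
the class / line datum. NOT a class theorem; no label, tier or count of record moves.

References: [Delbourgo1998] Prop. 4, Main Conjecture p. 151; [Wuthrich2014] Thm. 16; [Pal2012] Thm. 3.2;
[GreenbergVatsal2000] §2 (11), (16), Props. (2.6), (2.8), Cor. (2.3); [MazurTateTeitelbaum1986Invent]
§I.13–I.14; [SilvermanATAEC1994] V.5.3, V.5.4; [GreenbergLNM1716] Prop. 4.14, §5 p. 143; [Miller2011LMS] Def. 1.1.
-/

set_option autoImplicit false

noncomputable section

open scoped Classical MatrixGroups ModularForm

namespace Summit.BirchSwinnertonDyer.Rank1Residual.Additive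

open CongruenceSubgroup WeierstrassCurve NumberField IsDedekindDomain Field
  Literature.NumberTheory.EllipticCurves
  Literature.NumberTheory.EllipticCurves.ModularForms
  Literature.NumberTheory.EllipticCurves.GreenbergVatsal2000
  Literature.NumberTheory.EllipticCurves.Rank1Residual
  Literature.NumberTheory.EllipticCurves.Rank1Residual.Typed
  Literature.NumberTheory.GaloisRepresentations
  Summit.BirchSwinnertonDyer.Rank1Residual.X1.MuLambda
  Summit.BirchSwinnertonDyer.Rank1Residual.AdditivePotMult
  Summit.BirchSwinnertonDyer.Rank1Residual.Additive.X3Branch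

/-! ### §1 The `T = 0` LOWER inputs on X3♯(M) from the two per-pair inputs -/

section LowerInputs

variable {W : WeierstrassCurve ℚ} [W.IsElliptic] [W.IsGloballyMinimal] {p : ℕ} [hp : Fact p.Prime]

/-- **X3♯(M), `p ≡ 1 (mod 4)`: additive-p2's `T = 0` LOWER input `ChiBranchLowerLeadingTermAt W p`
from `hW16` + the `W`-keyed unit-coefficient certificate + `hLamW`** — twin of bsd-addord's
`ClassX3M.chiBranchLowerLeadingTermAt_of_multBranchCongruence_of_facts_of_lifting` with
{`hGVM`, `h23`, `h414`, `hT40`, `hT41`, `hlift`, `Φ₀`} ↦ {`hcert`, `hLamW`} (every twist model is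
multiplicative, `ClassX3M.mult_of_twist_model_pStar`; §2 at the PLUS multiplicative half branch of
additive-p1's `exists_halfBranchMult_even`; constant term read off).
[cite: MazurTateTeitelbaum1986Invent, §I.14] [cite: Wuthrich2014, Thm. 16 (p. 397)]
[cite: SilvermanATAEC1994, V.5.3] -/
theorem ClassX3M.chiBranchLowerLeadingTermAt_of_unitCoeffCert_of_lamEqW
    (hW16 : Wuthrich2014.thm16_halfEigenCharIdeal_dvd_cyclotomicPrime) (hX : ClassX3M W p) {n : ℕ}
    (hcert : ∀ (V : WeierstrassCurve ℚ) [V.IsElliptic] [V.IsGloballyMinimal] (C : VariableChange ℚ),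
      C • V.quadraticTwist ((-1) ^ (p / 2) * p : ℚ) = W → X3BranchUnitCoeffCertAt V p n)
    (hLamW : ∀ {κ : ZpExtension ℚ p} {γ : Field.absoluteGaloisGroup ℚ} (D : W.SelmerDualData κ γ)
      (g : IwasawaAlgebra p), κ.IsCyclotomic → κ.IsTopGenerator γ → D.IsTorsion →
      D.charIdeal = Ideal.span {g} → HasUnitContent g → lam g = n) :
    ChiBranchLowerLeadingTermAt W p := by
  intro V _ _ κ γ N _ f hp1 hCW _ hκ hγ hcv hf D ϖ hϖ g hg
  have hp2 : p ≠ 2 := by omega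
  have heven' : Even (p / 2) := ⟨p / 4, by omega⟩
  have hpS : ((-1 : ℚ) ^ (p / 2) * p) ≠ 0 := pStar_ne_zero p
  obtain ⟨C, hC⟩ := hCW
  have hC' : C • V.quadraticTwist ((-1) ^ (p / 2) * p : ℚ) = W := by
    rw [pStar_eq_self_of_mod_four_eq_one hp1]; exact hC
  have hmult : Mult V p := ClassX3M.mult_of_twist_model_pStar hX V C hC'
  have hirr : ¬ V.HasIrreducibleModPGaloisRep p := fun hV ↦
    hX.classX3.1 ((irr_iff_of_model_twist (W := V) (p := p) hpS ⟨C, hC'⟩).mpr hV)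
  obtain ⟨B, e, hB, hB0⟩ := AdditivePotMult.exists_halfBranchMult_even p hp2 heven' hmult hf
  obtain ⟨-, g', hchar, u, hι⟩ :=
    X3Branch.charIdeal_eq_span_of_unitCoeffCert_of_lamEqW hW16 hp2 hirr hC' (hcert V C hC') hLamW hκ
      hγ hcv hf hB D ϖ (by rw [if_pos heven']; exact hϖ)
  have hg' : g ∈ Ideal.span ({g'} : Set (IwasawaAlgebra p)) := by rw [← hchar]; exact hg
  obtain ⟨a, rfl⟩ := Ideal.mem_span_singleton'.mp hg'
  have hCu : PowerSeries.C ((((u : ℤ_[p]) : ℚ_[p])) * (ϖ : ℚ_[p])) =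
      PowerSeries.C (((u : ℤ_[p]) : ℚ_[p])) * PowerSeries.C (ϖ : ℚ_[p]) := map_mul _ _ _
  have hιg : iwasawaToPowerSeries p (a * g') =
      iwasawaToPowerSeries p (PowerSeries.C (u : ℤ_[p]) * a) *
        (PowerSeries.C ((ϖ : ℚ) : ℚ_[p]) * B) := by
    rw [map_mul, hι, iwasawaToPowerSeries_C_mul', hCu]
    ring
  suffices key : ∀ g₀ h₀ : IwasawaAlgebra p, iwasawaToPowerSeries p g₀ =
      iwasawaToPowerSeries p h₀ * (PowerSeries.C ((ϖ : ℚ) : ℚ_[p]) * B) →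
      ∃ h : ℤ_[p], ((PowerSeries.constantCoeff g₀ : ℤ_[p]) : ℚ_[p]) =
        (h : ℚ_[p]) * (ϖ : ℚ_[p]) * (legendrePlusSymbolSum f p : ℚ_[p]) from key (a * g') _ hιg
  intro g₀ h₀ hιg₀
  refine ⟨PowerSeries.constantCoeff h₀ * (e : ℤ_[p]), ?_⟩
  have h0 := congrArg PowerSeries.constantCoeff hιg₀
  rw [constantCoeff_iwasawaToPowerSeries, map_mul, map_mul, constantCoeff_iwasawaToPowerSeries,
    PowerSeries.constantCoeff_C, hB0] at h0
  rw [h0, PadicInt.coe_mul]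
  ring

/-- **X3♯(M), `p ≡ 3 (mod 4)` (`p = 3` included): the ODD `T = 0` LOWER input
`ChiBranchLowerLeadingTermOddAt W p` from `hW16` + the `W`-keyed certificate + `hLamW`** (MINUS
multiplicative half branch of additive-p1's `exists_halfBranchMult_odd`). Twin of bsd-addord's
`ClassX3M.chiBranchLowerLeadingTermOddAt_of_multBranchCongruence_of_facts_of_lifting`.
[cite: MazurTateTeitelbaum1986Invent, §I.13–I.14] [cite: Wuthrich2014, Thm. 16 (p. 397)]
[cite: SilvermanATAEC1994, V.5.3] -/
theorem ClassX3M.chiBranchLowerLeadingTermOddAt_of_unitCoeffCert_of_lamEqW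
    (hW16 : Wuthrich2014.thm16_halfEigenCharIdeal_dvd_cyclotomicPrime) (hX : ClassX3M W p) {n : ℕ}
    (hcert : ∀ (V : WeierstrassCurve ℚ) [V.IsElliptic] [V.IsGloballyMinimal] (C : VariableChange ℚ),
      C • V.quadraticTwist ((-1) ^ (p / 2) * p : ℚ) = W → X3BranchUnitCoeffCertAt V p n)
    (hLamW : ∀ {κ : ZpExtension ℚ p} {γ : Field.absoluteGaloisGroup ℚ} (D : W.SelmerDualData κ γ)
      (g : IwasawaAlgebra p), κ.IsCyclotomic → κ.IsTopGenerator γ → D.IsTorsion →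
      D.charIdeal = Ideal.span {g} → HasUnitContent g → lam g = n) :
    ChiBranchLowerLeadingTermOddAt W p := by
  intro V _ _ κ γ N _ f hp3 hCW _ hκ hγ hcv hf D ϖ hϖ g hg
  have hp2 : p ≠ 2 := by omega
  have hodd : ¬ Even (p / 2) := by rw [Nat.not_even_iff_odd]; exact ⟨p / 4, by omega⟩
  have hpS : ((-1 : ℚ) ^ (p / 2) * p) ≠ 0 := pStar_ne_zero p
  obtain ⟨C, hC⟩ := hCW
  have hC' : C • V.quadraticTwist ((-1) ^ (p / 2) * p : ℚ) = W := by
    rw [pStar_eq_neg_of_mod_four_eq_three hp3]; exact hC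
  have hmult : Mult V p := ClassX3M.mult_of_twist_model_pStar hX V C hC'
  have hirr : ¬ V.HasIrreducibleModPGaloisRep p := fun hV ↦
    hX.classX3.1 ((irr_iff_of_model_twist (W := V) (p := p) hpS ⟨C, hC'⟩).mpr hV)
  obtain ⟨B, e, hB, hB0⟩ := AdditivePotMult.exists_halfBranchMult_odd p hp2 hodd hmult hf
  obtain ⟨-, g', hchar, u, hι⟩ :=
    X3Branch.charIdeal_eq_span_of_unitCoeffCert_of_lamEqW hW16 hp2 hirr hC' (hcert V C hC') hLamW hκ
      hγ hcv hf hB D ϖ (by rw [if_neg hodd]; exact hϖ)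
  have hg' : g ∈ Ideal.span ({g'} : Set (IwasawaAlgebra p)) := by rw [← hchar]; exact hg
  obtain ⟨a, rfl⟩ := Ideal.mem_span_singleton'.mp hg'
  have hCu : PowerSeries.C ((((u : ℤ_[p]) : ℚ_[p])) * (ϖ : ℚ_[p])) =
      PowerSeries.C (((u : ℤ_[p]) : ℚ_[p])) * PowerSeries.C (ϖ : ℚ_[p]) := map_mul _ _ _
  have hιg : iwasawaToPowerSeries p (a * g') =
      iwasawaToPowerSeries p (PowerSeries.C (u : ℤ_[p]) * a) *
        (PowerSeries.C ((ϖ : ℚ) : ℚ_[p]) * B) := by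
    rw [map_mul, hι, iwasawaToPowerSeries_C_mul', hCu]
    ring
  suffices key : ∀ g₀ h₀ : IwasawaAlgebra p, iwasawaToPowerSeries p g₀ =
      iwasawaToPowerSeries p h₀ * (PowerSeries.C ((ϖ : ℚ) : ℚ_[p]) * B) →
      ∃ h : ℤ_[p], ((PowerSeries.constantCoeff g₀ : ℤ_[p]) : ℚ_[p]) =
        (h : ℚ_[p]) * (ϖ : ℚ_[p]) * (legendreMinusSymbolSum f p : ℚ_[p]) from key (a * g') _ hιg
  intro g₀ h₀ hιg₀
  refine ⟨PowerSeries.constantCoeff h₀ * (e : ℤ_[p]), ?_⟩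
  have h0 := congrArg PowerSeries.constantCoeff hιg₀
  rw [constantCoeff_iwasawaToPowerSeries, map_mul, map_mul, constantCoeff_iwasawaToPowerSeries,
    PowerSeries.constantCoeff_C, hB0] at h0
  rw [h0, PadicInt.coe_mul]
  ring

end LowerInputs

/-! ### §2 Rank-`0` END STATES on X3♯(M) -/

section EndStates

variable {W : WeierstrassCurve ℚ} [W.IsElliptic] [W.IsGloballyMinimal] {p : ℕ} [hp : Fact p.Prime]

/-- **X3♯(M) ∧ `r_an = 0`, every odd `p` (both parities): the N10 decl of record
`Typed.MissingLowerBoundAt W p` — the currency of route K1's crux `MultLower` on these rows — from the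
PUBLISHED records `hDelX` (Delbourgo 1998 Prop. 4, exact (M) form), `hPal`, `hGZK`, `hmod`, `hmodD`,
`hW16` + the TWO per-pair inputs `hcert` (unit coefficient of `ϖ·B_m` at index `n`, every twist
model) and `hLamW` (algebraic `λ` of `X(E/ℚ_∞)` equals `n`).** The `hGVM`-FREE twin of bsd-addord's
(M) end state. NOT a class theorem; nothing booked. [cite: Delbourgo1998, Prop. 4 (p. 144), §2.2 Lemma (ii) (p. 139)]
[cite: Pal2012, Thm. 3.2] [cite: Wuthrich2014, Thm. 16 (p. 397)] [cite: MazurTateTeitelbaum1986Invent, §I.13–I.14] -/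
theorem ClassX3M.missingLowerBoundAt_rankZero_of_unitCoeffCert_of_lamEqW
    (hDelX : Delbourgo1998.prop4_rankZero_constantCoeff_eq_unit_mul_of_potMult)
    (hPal : Pal2012.thm32_sqrt_mul_realPeriodRat_twist_eq_of_prime_one_mod_four)
    (hGZK : rank_eq_analyticRank_of_analyticRank_le_one) (hmod : hasEntireLFunction_rat)
    (hmodD : nonempty_modularParametrizationData)
    (hW16 : Wuthrich2014.thm16_halfEigenCharIdeal_dvd_cyclotomicPrime)
    (hX : ClassX3M W p) (hr : W.analyticRank = 0) {n : ℕ}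
    (hcert : ∀ (V : WeierstrassCurve ℚ) [V.IsElliptic] [V.IsGloballyMinimal] (C : VariableChange ℚ),
      C • V.quadraticTwist ((-1) ^ (p / 2) * p : ℚ) = W → X3BranchUnitCoeffCertAt V p n)
    (hLamW : ∀ {κ : ZpExtension ℚ p} {γ : Field.absoluteGaloisGroup ℚ} (D : W.SelmerDualData κ γ)
      (g : IwasawaAlgebra p), κ.IsCyclotomic → κ.IsTopGenerator γ → D.IsTorsion →
      D.charIdeal = Ideal.span {g} → HasUnitContent g → lam g = n) :
    MissingLowerBoundAt W p := by
  have hodd := hp.out.eq_two_or_odd'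
  have hp2 : p ≠ 2 := ClassX3M.p_ne_two W p hX
  by_cases hp4 : p % 4 = 1
  · exact ClassX3M.missingLowerBoundAt_rankZero_of_chiBranchLower hDelX hPal hGZK hmod hmodD hX hp4 hr
      (ClassX3M.chiBranchLowerLeadingTermAt_of_unitCoeffCert_of_lamEqW hW16 hX hcert hLamW)
  · have hp4' : p % 4 = 3 := by
      rcases hodd with h | h
      · exact absurd h hp2
      · obtain ⟨k, hk⟩ := h; omega
    exact ClassX3M.missingLowerBoundAt_rankZero_of_chiBranchLowerOdd hDelX hGZK hmod hmodD hX hp4' hr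
      (ClassX3M.chiBranchLowerLeadingTermOddAt_of_unitCoeffCert_of_lamEqW hW16 hX hcert hLamW)

/-- **X3♯(M) ∧ `r_an = 0`, every odd `p`: Miller's `BSD(E,p)` from the PUBLISHED records + the two
per-pair inputs** — the `hGVM`-FREE twin of bsd-addord's
`ClassX3M.bsdp_rankZero_of_multBranchCongruence_of_facts_of_lifting` ({`hGVM`, `h23`, `h414`,
`hT40`, `hT41`, `hlift`, `Φ₀`} ↦ {`hcert`, `hLamW`}). Into additive-p1's
`ClassX3M.bsdp_rankZero_of_chiBranchLower[Odd]`, parity split inside. NOT a class theorem; nothing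
booked. [cite: Delbourgo1998, Prop. 4 (p. 144), Main Conjecture p. 151] [cite: Wuthrich2014, Thm. 16 (p. 397)]
[cite: Pal2012, Thm. 3.2] [cite: Miller2011LMS, §1 and Def. 1.1] -/
theorem ClassX3M.bsdp_rankZero_of_unitCoeffCert_of_lamEqW
    (hDel98 : Delbourgo1998.prop4_rankZero_pow_dvd_constantCoeff)
    (hDelX : Delbourgo1998.prop4_rankZero_constantCoeff_eq_unit_mul_of_potMult)
    (hPal : Pal2012.thm32_sqrt_mul_realPeriodRat_twist_eq_of_prime_one_mod_four)
    (hGZK : rank_eq_analyticRank_of_analyticRank_le_one) (hmod : hasEntireLFunction_rat)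
    (hmodD : nonempty_modularParametrizationData)
    (hW16 : Wuthrich2014.thm16_halfEigenCharIdeal_dvd_cyclotomicPrime)
    (hX : ClassX3M W p) (hr : W.analyticRank = 0) {n : ℕ}
    (hcert : ∀ (V : WeierstrassCurve ℚ) [V.IsElliptic] [V.IsGloballyMinimal] (C : VariableChange ℚ),
      C • V.quadraticTwist ((-1) ^ (p / 2) * p : ℚ) = W → X3BranchUnitCoeffCertAt V p n)
    (hLamW : ∀ {κ : ZpExtension ℚ p} {γ : Field.absoluteGaloisGroup ℚ} (D : W.SelmerDualData κ γ)
      (g : IwasawaAlgebra p), κ.IsCyclotomic → κ.IsTopGenerator γ → D.IsTorsion →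
      D.charIdeal = Ideal.span {g} → HasUnitContent g → lam g = n) :
    BSDp W p := by
  have hodd := hp.out.eq_two_or_odd'
  have hp2 : p ≠ 2 := ClassX3M.p_ne_two W p hX
  by_cases hp4 : p % 4 = 1
  · exact ClassX3M.bsdp_rankZero_of_chiBranchLower hDel98 hDelX hPal hGZK hmod hmodD hW16 hX hp4 hr
      (ClassX3M.chiBranchLowerLeadingTermAt_of_unitCoeffCert_of_lamEqW hW16 hX hcert hLamW)
  · have hp4' : p % 4 = 3 := by
      rcases hodd with h | h
      · exact absurd h hp2
      · obtain ⟨k, hk⟩ := h; omega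
    exact ClassX3M.bsdp_rankZero_of_chiBranchLowerOdd hDel98 hDelX hGZK hmod hmodD hW16 hX hp4' hr
      (ClassX3M.chiBranchLowerLeadingTermOddAt_of_unitCoeffCert_of_lamEqW hW16 hX hcert hLamW)

end EndStates

/-! ### §3 `hLamW` on (M) from bsd-addord's COUNT + the displayed EVALUATION -/

section Evaluation

variable {W : WeierstrassCurve ℚ} [W.IsElliptic] [W.IsGloballyMinimal] {p : ℕ} [hp : Fact p.Prime]

/-- **(M): `hLamW` from the PUBLISHED records `h23`, `h414`, `hT40`, `hT41` + `Φ₀` (even, non-trivial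
action, `χ`-twist ramified) + the displayed residual lifting `hlift` + the evaluation `hn`**
(bsd-addord's `X3Branch.algebraicCountWMult_of_facts_of_lifting`). With §4 this is the
`hGVM`-FREE per-pair road on X3♯(M) ∧ `r_an = 0`: PUBLISHED records + `Φ₀` + `hlift` (= the
reading-facts `residualEpsilon_surjOn_of_line[Ramified]Even`) + ONE unit-coefficient certificate +
ONE evaluation of the residual count. [cite: GreenbergVatsal2000, §2 (11), (16), pp. 26–30, Props. (2.6), (2.8), Cor. (2.3)]
[cite: GreenbergLNM1716, Prop. 4.14] [cite: SilvermanATAEC1994, Ch. V Thm. 5.3, Cor. 5.4] -/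
theorem X3Branch.lamEqW_mult_of_facts_of_lifting_of_eval
    (h23 : datumSelmer_nonPrimitive_invariants)
    (h414 : Greenberg1999.prop414_noFiniteSubmodule_of_not_dvd_torsionOrder)
    (hT40 : Silverman1994_thmV53_tateUniformisation.{0})
    (hT41 : Silverman1994_thmV53_corV54_tateUniformisation.{0})
    (hp2 : p ≠ 2) (hpm : AdditivePotMult.PotMult W p) (V : WeierstrassCurve ℚ) [V.IsElliptic]
    [V.IsGloballyMinimal] (hmult : Mult V p) {C : VariableChange ℚ}
    (hC : C • V.quadraticTwist ((-1 : ℚ) ^ (p / 2) * p) = W)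
    (S₀ : Finset (HeightOneSpectrum (𝓞 ℚ))) (hS₀ : ∀ v ∈ S₀, ((p : ℕ) : 𝓞 ℚ) ∉ v.asIdeal)
    (hS : ∀ v : HeightOneSpectrum (𝓞 ℚ), v ∉ S₀ → ((p : ℕ) : 𝓞 ℚ) ∉ v.asIdeal →
      W.HasGoodReductionAt v)
    (Φ₀ : AddSubgroup (W.geomTorsion (p : ℤ))) (hΦ : IsRationalLine W p Φ₀)
    (heven : LineEven W p Φ₀)
    (hnt : ∃ (σ : absoluteGaloisGroup ℚ) (P : W.geomTorsion (p : ℤ)), P ∈ Φ₀ ∧ σ • P ≠ P)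
    (hram : ∀ (K : Type) [Field K] [NumberField K] [(galRange (K := ℚ) K).Normal],
      Module.finrank ℚ K = 2 → (∃ θ : K, θ ^ 2 = algebraMap ℚ K ((-1) ^ (p / 2) * p)) →
      ¬ ∀ v : HeightOneSpectrum (𝓞 ℚ), ((p : ℕ) : 𝓞 ℚ) ∈ v.asIdeal →
        ∀ 𝔓 ∈ v.primesAbove, ∀ σ ∈ 𝔓.inertia (absoluteGaloisGroup ℚ), ∀ P ∈ Φ₀,
          σ • P = (if σ ∈ galRange (K := ℚ) K then P else -P))
    (hlift : ∀ (κ : ZpExtension ℚ p), κ.IsCyclotomic →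
      ∀ s ∈ residualQuotSelmer W p κ S₀ Φ₀ hΦ, ∃ x ∈ residualTorsionH1 W p κ S₀,
        residualEpsilon W p κ Φ₀ hΦ x = s)
    {n : ℕ}
    (hn : ∀ (κ : ZpExtension ℚ p), κ.IsCyclotomic →
      p ^ (n + ∑ v ∈ S₀, delta W p v) =
        Nat.card (residualLineH1 W p κ S₀ Φ₀ hΦ) * Nat.card (residualQuotSelmer W p κ S₀ Φ₀ hΦ))
    {κ : ZpExtension ℚ p} {γ : Field.absoluteGaloisGroup ℚ} (D : W.SelmerDualData κ γ)
    (g : IwasawaAlgebra p) (hκ : κ.IsCyclotomic) (hγ : κ.IsTopGenerator γ) (hDt : D.IsTorsion)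
    (hchar : D.charIdeal = Ideal.span {g}) (hμg : HasUnitContent g) : lam g = n :=
  X3Branch.lamEqW_of_count_of_eval S₀ hΦ
    (fun D g hκ' hγ' hDt' hg hμ ↦ X3Branch.algebraicCountWMult_of_facts_of_lifting h23 h414 hT40 hT41
      hp2 hpm V hmult hC S₀ hS₀ hS Φ₀ hΦ heven hnt hram hlift D g hκ' hγ' hDt' hg hμ)
    hn D g hκ hγ hDt hchar hμg

end Evaluation

/-! ### §4 The certificate in the census cell's Q6 RECORD FORMAT (`CensusQ6.Mult[Odd]FirstUnitIndexAt`) -/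

section Records

variable {W : WeierstrassCurve ℚ} [W.IsElliptic] [W.IsGloballyMinimal] {p : ℕ} [hp : Fact p.Prime]

/-- **Q6 record ⟹ the `W`-keyed certificate on X3♯(M), `p ≡ 1 (mod 4)`.** The census cell's
first-unit-index record `CensusQ6.MultFirstUnitIndexAt W p n₀` (PREDICTIONS-Q6 §5 PASS row: two
engines agree on `n₀`, `c_{n₀}` a certified unit of the Néron-normalised PLUS multiplicative branch
`ϖ·L_p^+(f, a_p, ω^{(p−1)/2}, T)` of EVERY multiplicative twist model) gives
`X3BranchUnitCoeffCertAt V p n₀` for every twist model `V` of `W` (all multiplicative,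
`ClassX3M.mult_of_twist_model_pStar`; the good-ordinary disjunct of the telescope is void, the
split / non-split disjuncts are the record at `a_p = ±1`,
`IsNewformOf.cuspCoeff_eq_one_and_sq_of_split` / `…_eq_neg_one_and_dvd_of_nonsplit`).
[cite: MazurTateTeitelbaum1986Invent, §I.13] [cite: SilvermanAEC2009, VII.5 Prop. 5.1] -/
theorem ClassX3M.unitCoeffCert_of_multFirstUnitIndex (hX : ClassX3M W p) (hp4 : p % 4 = 1) {n₀ : ℕ}
    (h : CensusQ6.MultFirstUnitIndexAt W p n₀)
    (V : WeierstrassCurve ℚ) [V.IsElliptic] [V.IsGloballyMinimal] (C : VariableChange ℚ)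
    (hC : C • V.quadraticTwist ((-1) ^ (p / 2) * p : ℚ) = W) : X3BranchUnitCoeffCertAt V p n₀ := by
  intro N _ f B ϖ hred hf hϖ
  have heven' : Even (p / 2) := ⟨p / 4, by omega⟩
  have hmult : Mult V p := ClassX3M.mult_of_twist_model_pStar hX V C hC
  have hC' : C • V.quadraticTwist (p : ℚ) = W := by
    rw [← pStar_eq_self_of_mod_four_eq_one hp4]; exact hC
  rw [if_pos heven'] at hϖ
  rcases hred with ⟨hord, -⟩ | ⟨hs, hB⟩ | ⟨hm, hns, hB⟩
  · exact absurd ((isOrdinaryAt_iff V p).mp hord).1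
      (not_hasGoodReductionAtPrime_of_hasMultiplicativeReductionAtPrime p hmult)
  · obtain ⟨hap, -⟩ := hf.cuspCoeff_eq_one_and_sq_of_split hs
    have key := (h V C hmult hC' f hf 1 (by rw [hap]; norm_num) ϖ hϖ).2
    rw [hB, if_pos heven']
    simpa only [Int.cast_one] using key
  · obtain ⟨hap, -⟩ := hf.cuspCoeff_eq_neg_one_and_dvd_of_nonsplit hm hns
    have key := (h V C hmult hC' f hf (-1) (by rw [hap]; norm_num) ϖ hϖ).2
    rw [hB, if_pos heven']
    simpa only [Int.cast_neg, Int.cast_one] using key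

/-- **Q6 record ⟹ the `W`-keyed certificate on X3♯(M), `p ≡ 3 (mod 4)`** (`p = 3` included; MINUS
multiplicative branch, twist by `−p`, `Ω⁻`; record `CensusQ6.MultOddFirstUnitIndexAt W p n₀`).
[cite: MazurTateTeitelbaum1986Invent, §I.13] [cite: SilvermanAEC2009, VII.5 Prop. 5.1] -/
theorem ClassX3M.unitCoeffCert_of_multOddFirstUnitIndex (hX : ClassX3M W p) (hp4 : p % 4 = 3)
    {n₀ : ℕ} (h : CensusQ6.MultOddFirstUnitIndexAt W p n₀)
    (V : WeierstrassCurve ℚ) [V.IsElliptic] [V.IsGloballyMinimal] (C : VariableChange ℚ)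
    (hC : C • V.quadraticTwist ((-1) ^ (p / 2) * p : ℚ) = W) : X3BranchUnitCoeffCertAt V p n₀ := by
  intro N _ f B ϖ hred hf hϖ
  have hodd : ¬ Even (p / 2) := by rw [Nat.not_even_iff_odd]; exact ⟨p / 4, by omega⟩
  have hmult : Mult V p := ClassX3M.mult_of_twist_model_pStar hX V C hC
  have hC' : C • V.quadraticTwist (-(p : ℚ)) = W := by
    rw [← pStar_eq_neg_of_mod_four_eq_three hp4]; exact hC
  rw [if_neg hodd] at hϖ
  rcases hred with ⟨hord, -⟩ | ⟨hs, hB⟩ | ⟨hm, hns, hB⟩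
  · exact absurd ((isOrdinaryAt_iff V p).mp hord).1
      (not_hasGoodReductionAtPrime_of_hasMultiplicativeReductionAtPrime p hmult)
  · obtain ⟨hap, -⟩ := hf.cuspCoeff_eq_one_and_sq_of_split hs
    have key := (h V C hmult hC' f hf 1 (by rw [hap]; norm_num) ϖ hϖ).2
    rw [hB, if_neg hodd]
    simpa only [Int.cast_one] using key
  · obtain ⟨hap, -⟩ := hf.cuspCoeff_eq_neg_one_and_dvd_of_nonsplit hm hns
    have key := (h V C hmult hC' f hf (-1) (by rw [hap]; norm_num) ϖ hϖ).2
    rw [hB, if_neg hodd]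
    simpa only [Int.cast_neg, Int.cast_one] using key

/-- **X3♯(M) ∧ `r_an = 0`, `p ≡ 1 (mod 4)`: `Typed.MissingLowerBoundAt W p` ON A Q6 RECORD** — from
the PUBLISHED records + `CensusQ6.MultFirstUnitIndexAt W p n₀` + `hLamW` (algebraic `λ = n₀`). The
per-pair closing shape of route K1's crux `MultLower` on these rows: one TSV row of the Q6
instrument (PREDICTIONS-Q6 §5) + the algebraic `λ`. NOT a class theorem; nothing booked.
[cite: Delbourgo1998, Prop. 4 (p. 144)] [cite: Pal2012, Thm. 3.2] [cite: Wuthrich2014, Thm. 16 (p. 397)]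
[cite: MazurTateTeitelbaum1986Invent, §I.13–I.14] -/
theorem ClassX3M.missingLowerBoundAt_rankZero_of_multFirstUnitIndex_of_lamEqW
    (hDelX : Delbourgo1998.prop4_rankZero_constantCoeff_eq_unit_mul_of_potMult)
    (hPal : Pal2012.thm32_sqrt_mul_realPeriodRat_twist_eq_of_prime_one_mod_four)
    (hGZK : rank_eq_analyticRank_of_analyticRank_le_one) (hmod : hasEntireLFunction_rat)
    (hmodD : nonempty_modularParametrizationData)
    (hW16 : Wuthrich2014.thm16_halfEigenCharIdeal_dvd_cyclotomicPrime)
    (hX : ClassX3M W p) (hp4 : p % 4 = 1) (hr : W.analyticRank = 0) {n₀ : ℕ}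
    (hrec : CensusQ6.MultFirstUnitIndexAt W p n₀)
    (hLamW : ∀ {κ : ZpExtension ℚ p} {γ : Field.absoluteGaloisGroup ℚ} (D : W.SelmerDualData κ γ)
      (g : IwasawaAlgebra p), κ.IsCyclotomic → κ.IsTopGenerator γ → D.IsTorsion →
      D.charIdeal = Ideal.span {g} → HasUnitContent g → lam g = n₀) :
    MissingLowerBoundAt W p :=
  ClassX3M.missingLowerBoundAt_rankZero_of_unitCoeffCert_of_lamEqW hDelX hPal hGZK hmod hmodD hW16 hX
    hr (fun V _ _ C hC ↦ ClassX3M.unitCoeffCert_of_multFirstUnitIndex hX hp4 hrec V C hC) hLamW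

/-- **X3♯(M) ∧ `r_an = 0`, `p ≡ 3 (mod 4)` (`p = 3` included): `Typed.MissingLowerBoundAt W p` ON A
Q6 RECORD** (`CensusQ6.MultOddFirstUnitIndexAt W p n₀` + `hLamW`).
[cite: Delbourgo1998, Prop. 4 (p. 144)] [cite: Wuthrich2014, Thm. 16 (p. 397)]
[cite: MazurTateTeitelbaum1986Invent, §I.13–I.14] -/
theorem ClassX3M.missingLowerBoundAt_rankZero_of_multOddFirstUnitIndex_of_lamEqW
    (hDelX : Delbourgo1998.prop4_rankZero_constantCoeff_eq_unit_mul_of_potMult)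
    (hPal : Pal2012.thm32_sqrt_mul_realPeriodRat_twist_eq_of_prime_one_mod_four)
    (hGZK : rank_eq_analyticRank_of_analyticRank_le_one) (hmod : hasEntireLFunction_rat)
    (hmodD : nonempty_modularParametrizationData)
    (hW16 : Wuthrich2014.thm16_halfEigenCharIdeal_dvd_cyclotomicPrime)
    (hX : ClassX3M W p) (hp4 : p % 4 = 3) (hr : W.analyticRank = 0) {n₀ : ℕ}
    (hrec : CensusQ6.MultOddFirstUnitIndexAt W p n₀)
    (hLamW : ∀ {κ : ZpExtension ℚ p} {γ : Field.absoluteGaloisGroup ℚ} (D : W.SelmerDualData κ γ)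
      (g : IwasawaAlgebra p), κ.IsCyclotomic → κ.IsTopGenerator γ → D.IsTorsion →
      D.charIdeal = Ideal.span {g} → HasUnitContent g → lam g = n₀) :
    MissingLowerBoundAt W p :=
  ClassX3M.missingLowerBoundAt_rankZero_of_unitCoeffCert_of_lamEqW hDelX hPal hGZK hmod hmodD hW16 hX
    hr (fun V _ _ C hC ↦ ClassX3M.unitCoeffCert_of_multOddFirstUnitIndex hX hp4 hrec V C hC) hLamW

end Records

end Summit.BirchSwinnertonDyer.Rank1Residual.Additive

end
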